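import Summits.CriticalPhenomena.PercolationContinuityZ3.Theorems.Transplant.SkelFrmFromBParamsSlotsRS
import Summits.CriticalPhenomena.PercolationContinuityZ3.Theorems.Transplant.SkelFrmBParamsSlotsRS
import Summits.CriticalPhenomena.PercolationContinuityZ3.Theorems.Transplant.SkelNegBParamsSlotsRS
import Summits.CriticalPhenomena.PercolationContinuityZ3.Theorems.Transplant.SkelFrmFromBParamsFineSize
import Summits.CriticalPhenomena.PercolationContinuityZ3.Theorems.Transplant.SkelFrmBParamsFineSize
import Summits.CriticalPhenomena.PercolationContinuityZ3.Theorems.Transplant.SkelNegBParamsFineSize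
import Summits.CriticalPhenomena.PercolationContinuityZ3.Theorems.Transplant.SkelFrmFrom1SlotTypes
import Summits.CriticalPhenomena.PercolationContinuityZ3.Theorems.Transplant.SkelFrm1SlotTypes
import Summits.CriticalPhenomena.PercolationContinuityZ3.Theorems.Transplant.SkelFrmFrom1ParamsPO
import Summits.CriticalPhenomena.PercolationContinuityZ3.Theorems.Transplant.SkelFrm1ParamsPO
import Summits.CriticalPhenomena.PercolationContinuityZ3.Theorems.Transplant.SkelFrmFrom1ParamsLBL
import Summits.CriticalPhenomena.PercolationContinuityZ3.Theorems.Transplant.SkelFrm1ParamsLBL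
import Summits.CriticalPhenomena.PercolationContinuityZ3.Theorems.Transplant.SkelFrmFromBParamsKitA
import Summits.CriticalPhenomena.PercolationContinuityZ3.Theorems.Transplant.SkelFrmBParamsKitA
import Summits.CriticalPhenomena.PercolationContinuityZ3.Theorems.Transplant.SkelFrmFromBParamsKitS
import Summits.CriticalPhenomena.PercolationContinuityZ3.Theorems.Transplant.SkelFrmBParamsKitS
import Summits.CriticalPhenomena.PercolationContinuityZ3.Theorems.Transplant.SkelFrmFrom1ParamsLF
import Summits.CriticalPhenomena.PercolationContinuityZ3.Theorems.Transplant.SkelFrm1ParamsLF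
import Summits.CriticalPhenomena.PercolationContinuityZ3.Theorems.Transplant.SkelFrmFrom1ParamsLO
import Summits.CriticalPhenomena.PercolationContinuityZ3.Theorems.Transplant.SkelFrm1ParamsLO
import Summits.CriticalPhenomena.PercolationContinuityZ3.Theorems.Transplant.SkelFrmFromBParamsLF
import Summits.CriticalPhenomena.PercolationContinuityZ3.Theorems.Transplant.SkelFrmBParamsLF
import Summits.CriticalPhenomena.PercolationContinuityZ3.Theorems.Transplant.SkelFrmFromBParamsLO
import Summits.CriticalPhenomena.PercolationContinuityZ3.Theorems.Transplant.SkelFrmBParamsLO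
import Summits.CriticalPhenomena.PercolationContinuityZ3.Theorems.Transplant.SkelFrmFromBParamsB
import Summits.CriticalPhenomena.PercolationContinuityZ3.Theorems.Transplant.SkelFrmBParamsB
import Summits.CriticalPhenomena.PercolationContinuityZ3.Theorems.Transplant.SkelFrmFromBParamsSlotsR
import Summits.CriticalPhenomena.PercolationContinuityZ3.Theorems.Transplant.SkelFrmBParamsSlotsR
import Summits.CriticalPhenomena.PercolationContinuityZ3.Theorems.Transplant.SkelNegBParamsSlots
import Summits.CriticalPhenomena.PercolationContinuityZ3.Theorems.Transplant.PlanarSkeletonFrmFromDefs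
import Summits.CriticalPhenomena.PercolationContinuityZ3.Theorems.Transplant.PlanarSkeletonFrmDefs
import Summits.CriticalPhenomena.PercolationContinuityZ3.Theorems.Transplant.SkelPhiStepIDataNS
import HarnessLib
import Summits.CriticalPhenomena.PercolationContinuityZ3.Theorems.Transplant.SkelFrmBParamsSlots
/-!
# U-WAVE PORT (RULING D-U, lead g21 2026-08-26; WAVE-U-MANIFEST v3.1 row «SkelFrmBParamsSlots» ↦ «SkelFrmFromBParamsSlots») of the tree module
# `Transplant/SkelFrmBParamsSlots` onto the carrier `PlanarSkeletonFrmFrom` (frames only, cylinders connected from width `ℓ₀` on)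

ORIGINAL TITLE: N2 (frames-only node `SamePDropOfSkeletonFrmFrom₁`, OPEN) params column over `PlanarSkeletonFrm` — (ζ″) ledger, shape (B′) of record ((R-14)):

builds on p205010 (kernel theorem, internal audit signed; external expert review pending) — nothing in this file uses p205010; NOTHING is claimed about the
OPEN node U `SamePDropOfSkeletonFrmFrom₁` (nor U_s / the end state).  Lane `prim-bschramm`, seat `prim-bschramm-stmt` gen 26 (port pen, RULING M-11 family P-stmt; tool = p3-g26's port_u.py of record, registry-driven inputs); helper file
(`--supports stmt-CriticalPhenomena-4575 --as helper`).  PORT RULES r1–r4 of RULING D-U: declaration order and proof texts are those of the original,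
byte-identical except (i) the carrier token `PlanarSkeletonFrm ↦ PlanarSkeletonFrmFrom` (binders, `namespace`/`end` lines, qualified names of twinned
declarations), (ii) carrier-FREE declarations of the original (φ-level `Skelφ…` blocks and namespace-only arithmetic residents) are NOT re-declared —
this file imports the original and `export`s the twin-free residents (POLICY T / treatment (m1)); residents whose statement mentions a twinned
constant are copied, (iii) every carrier-binding declaration keeps its explicit binder `(Φ : PlanarSkeletonFrmFrom G)` in its own signature (r2).  Docstrings and citations are the original's.
-/

noncomputable section

open scoped Classical

namespace Summit.CriticalPhenomena.PercolationContinuityZ3.Theorems.Transplant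

namespace PlanarSkeletonFrmFrom

namespace NegB

namespace KS

open MeasureTheory Literature.Probability.Percolation Literature.Probability.LatticeModels SimpleGraph
open SkelConc (Consts)
open Skelφ (oriφ trφ)
open Skelφ.StepI (DataN OutO)
open Neg

/-! ## §1 The box slot value -/

/-- **THE BOX FLOOR OF RECORD** (kit index slot `mk`, residual slot `gx`): `g := max {4K(RA'+2), 16(n_b + ℓ_b + |h_b|), gx}` at the merged record. [this work] -/
def gR  (mk gx : ℕ) : Neg.FSlot := fun κ _ _ _ _ _ Φ t p D =>
  max (max (4 * Neg.K κ * (RA' κ Φ t p D mk + 2)) (16 * (nBR κ Φ t p D mk + ℓBR κ Φ t p D mk + (hBR κ Φ t p D mk).natAbs))) gx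

section Box

/-- `gR` at `(κ, Φ, t, p, D)` (by `rfl`). [folklore] -/
theorem gR_at (κ : Consts) {V : Type} [DecidableEq V] [Countable V] {G : SimpleGraph V} [G.LocallyFinite] (Φ : PlanarSkeletonFrmFrom G) (t : V) (p : unitInterval) (D : Skelφ.StepI.DataNS V) (mk : ℕ) (gx : ℕ) : gR mk gx κ Φ t p D =
    max (max (4 * Neg.K κ * (RA' κ Φ t p D mk + 2)) (16 * (nBR κ Φ t p D mk + ℓBR κ Φ t p D mk + (hBR κ Φ t p D mk).natAbs))) gx := rfl

/-- The three floors inside `gR`. [folklore] -/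
theorem gR_floors (κ : Consts) {V : Type} [DecidableEq V] [Countable V] {G : SimpleGraph V} [G.LocallyFinite] (Φ : PlanarSkeletonFrmFrom G) (t : V) (p : unitInterval) (D : Skelφ.StepI.DataNS V) (mk : ℕ) (gx : ℕ) : 4 * Neg.K κ * (RA' κ Φ t p D mk + 2) ≤ gR mk gx κ Φ t p D ∧
    16 * (nBR κ Φ t p D mk + ℓBR κ Φ t p D mk + (hBR κ Φ t p D mk).natAbs) ≤ gR mk gx κ Φ t p D ∧ gx ≤ gR mk gx κ Φ t p D :=
  ⟨(le_max_left _ _).trans (le_max_left _ _), (le_max_right _ _).trans (le_max_left _ _), le_max_right _ _⟩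

/-- **THE LONG BOX's FLOORS AT `g := gR`**: `4K(RA'+2) ≤ M_L`, `16(n_b+ℓ_b+|h_b|) ≤ M_L` (bridge ladder: `M_L + 1 ≥ 2C′(…) + 1`), `gx ≤ M_L`, `4K·RA' + 2 ≤ M_L`, `RA' + 2 ≤ M_L`.
[folklore] -/
theorem ML_floorsR (κ : Consts) {V : Type} [DecidableEq V] [Countable V] {G : SimpleGraph V} [G.LocallyFinite] (Φ : PlanarSkeletonFrmFrom G) (t : V) (p : unitInterval) (D : Skelφ.StepI.DataNS V) (mk : ℕ) (gx : ℕ) : 4 * Neg.K κ * (RA' κ Φ t p D mk + 2) ≤ ML κ Φ t p D (gR mk gx κ Φ t p D) ∧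
    16 * (nBR κ Φ t p D mk + ℓBR κ Φ t p D mk + (hBR κ Φ t p D mk).natAbs) ≤ ML κ Φ t p D (gR mk gx κ Φ t p D) ∧
    gx ≤ ML κ Φ t p D (gR mk gx κ Φ t p D) ∧ 4 * Neg.K κ * RA' κ Φ t p D mk + 2 ≤ ML κ Φ t p D (gR mk gx κ Φ t p D) ∧
    RA' κ Φ t p D mk + 2 ≤ ML κ Φ t p D (gR mk gx κ Φ t p D) := by
  have hg := (ML_le_ML κ Φ t p D (gR mk gx κ Φ t p D)).2
  obtain ⟨h1, h2, h3⟩ := gR_floors κ Φ t p D mk gx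
  have hK := (Neg.forty_le_K κ).1
  refine ⟨h1.trans hg, h2.trans hg, h3.trans hg, ?_, ?_⟩
  · have : 4 * Neg.K κ * RA' κ Φ t p D mk + 2 ≤ 4 * Neg.K κ * (RA' κ Φ t p D mk + 2) := by nlinarith
    exact this.trans (h1.trans hg)
  · have : RA' κ Φ t p D mk + 2 ≤ 4 * Neg.K κ * (RA' κ Φ t p D mk + 2) := by nlinarith
    exact this.trans (h1.trans hg)

/-- The ℤ form `4K(RA'+2) ≤ M_L`. [folklore] -/
theorem ML_floorR_int (κ : Consts) {V : Type} [DecidableEq V] [Countable V] {G : SimpleGraph V} [G.LocallyFinite] (Φ : PlanarSkeletonFrmFrom G) (t : V) (p : unitInterval) (D : Skelφ.StepI.DataNS V) (mk : ℕ) (gx : ℕ) : 4 * (Neg.K κ : ℤ) * ((RA' κ Φ t p D mk : ℤ) + 2) ≤ (ML κ Φ t p D (gR mk gx κ Φ t p D) : ℤ) := by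
  exact_mod_cast (ML_floorsR κ Φ t p D mk gx).1

end Box

/-! ## §2 The width slot value -/

/-- **THE WIDTH FLOOR OF RECORD** (slots `mk`, residual `fx`): `f := max {K(RA'+2), D.k + RA' + pgScale n_b h_b (3ℓ_b) + 1, fx}` ((R-F1) exact). [this work] -/
def fR  (mk fx : ℕ) : Neg.FSlot := fun κ _ _ _ _ _ Φ t p D =>
  max (max (Neg.K κ * (RA' κ Φ t p D mk + 2)) (D.k + RA' κ Φ t p D mk + Skelφ.pgScale (nBR κ Φ t p D mk) (hBR κ Φ t p D mk) (3 * ℓBR κ Φ t p D mk) + 1)) fx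

section Width

/-- `fR` at `(κ, Φ, t, p, D)` (by `rfl`). [folklore] -/
theorem fR_at (κ : Consts) {V : Type} [DecidableEq V] [Countable V] {G : SimpleGraph V} [G.LocallyFinite] (Φ : PlanarSkeletonFrmFrom G) (t : V) (p : unitInterval) (D : Skelφ.StepI.DataNS V) (mk : ℕ) (fx : ℕ) : fR mk fx κ Φ t p D =
    max (max (Neg.K κ * (RA' κ Φ t p D mk + 2)) (D.k + RA' κ Φ t p D mk + Skelφ.pgScale (nBR κ Φ t p D mk) (hBR κ Φ t p D mk) (3 * ℓBR κ Φ t p D mk) + 1)) fx :=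
  rfl

/-- The three floors inside `fR`. [folklore] -/
theorem fR_floors (κ : Consts) {V : Type} [DecidableEq V] [Countable V] {G : SimpleGraph V} [G.LocallyFinite] (Φ : PlanarSkeletonFrmFrom G) (t : V) (p : unitInterval) (D : Skelφ.StepI.DataNS V) (mk : ℕ) (fx : ℕ) : Neg.K κ * (RA' κ Φ t p D mk + 2) ≤ fR mk fx κ Φ t p D ∧
    D.k + RA' κ Φ t p D mk + Skelφ.pgScale (nBR κ Φ t p D mk) (hBR κ Φ t p D mk) (3 * ℓBR κ Φ t p D mk) + 1 ≤ fR mk fx κ Φ t p D ∧ fx ≤ fR mk fx κ Φ t p D :=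
  ⟨(le_max_left _ _).trans (le_max_left _ _), (le_max_right _ _).trans (le_max_left _ _), le_max_right _ _⟩

/-- **THE LONG WIDTH's FLOORS AT `f := fR`** (any box value `g`): `K(RA'+2) ≤ n_L`, (R-F1) `D.k + RA' + pgScale n_b h_b (3ℓ_b) + 1 ≤ n_L`, `fx ≤ n_L`, `RA' + 2 ≤ n_L`, `M_u < n_L`,
`n_b ≤ n_L`. [folklore] -/
theorem nL_floorsR (κ : Consts) {V : Type} [DecidableEq V] [Countable V] {G : SimpleGraph V} [G.LocallyFinite] (Φ : PlanarSkeletonFrmFrom G) (t : V) (p : unitInterval) (D : Skelφ.StepI.DataNS V) (mk : ℕ) (fx : ℕ) (g : ℕ) : Neg.K κ * (RA' κ Φ t p D mk + 2) ≤ nL κ Φ t p D g (fR mk fx κ Φ t p D) ∧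
    D.k + RA' κ Φ t p D mk + Skelφ.pgScale (nBR κ Φ t p D mk) (hBR κ Φ t p D mk) (3 * ℓBR κ Φ t p D mk) + 1 ≤ nL κ Φ t p D g (fR mk fx κ Φ t p D) ∧
    fx ≤ nL κ Φ t p D g (fR mk fx κ Φ t p D) ∧ RA' κ Φ t p D mk + 2 ≤ nL κ Φ t p D g (fR mk fx κ Φ t p D) ∧ Mu D < nL κ Φ t p D g (fR mk fx κ Φ t p D) ∧
    nBR κ Φ t p D mk ≤ nL κ Φ t p D g (fR mk fx κ Φ t p D) := by
  have hf := (n₁L_le_nL κ Φ t p D g (fR mk fx κ Φ t p D)).2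
  obtain ⟨h1, h2, h3⟩ := fR_floors κ Φ t p D mk fx
  have hK := (Neg.forty_le_K κ).2.2
  have hMu : Mu D < nL κ Φ t p D g (fR mk fx κ Φ t p D) := lt_of_le_of_lt (Mu_le_ML κ Φ t p D g) (ML_lt_nL κ Φ t p D g _).1
  refine ⟨h1.trans hf, h2.trans hf, h3.trans hf, ?_, hMu, ?_⟩
  · have : RA' κ Φ t p D mk + 2 ≤ Neg.K κ * (RA' κ Φ t p D mk + 2) := Nat.le_mul_of_pos_left _ hK
    exact this.trans (h1.trans hf)
  · have : nBR κ Φ t p D mk ≤ Skelφ.pgScale (nBR κ Φ t p D mk) (hBR κ Φ t p D mk) (3 * ℓBR κ Φ t p D mk) := le_max_left _ _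
    omega

end Width

/-! ## §3 The cells at the apron `R′` -/

section Cells

/-- **TRUE CELL SIZES UNDER A BOX FLOOR**: for ANY `r` with `4K(r+2) ≤ M_L`, `6r + 11 ≤ s₀` and `14r + 27 ≤ s₁` (from `true_size₀/₁`: `40·M_L ≤ 23·K·(s₀+2)`, `≤ 11·K·(s₁+2)`).
[folklore] -/
theorem s_ge_of_floor (κ : Consts) {V : Type} [DecidableEq V] [Countable V] {G : SimpleGraph V} [G.LocallyFinite] (Φ : PlanarSkeletonFrmFrom G) (t : V) (p : unitInterval) (D : Skelφ.StepI.DataNS V) (g : ℕ) (f : ℕ) (hN : EqNumL κ Φ t p D g f) (hκ : (hL κ Φ t p D g f).natAbs ≤ 10 * nL κ Φ t p D g f) {r : ℕ} (hr : 4 * Neg.K κ * (r + 2) ≤ ML κ Φ t p D g) :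
    6 * (r : ℤ) + 11 ≤ (((fcells κ Φ t p D g f).s 0 : ℕ) : ℤ) ∧ 14 * (r : ℤ) + 27 ≤ (((fcells κ Φ t p D g f).s 1 : ℕ) : ℤ) := by
  have h0 := true_size₀ κ Φ t p D g f hN hκ
  have h1 := true_size₁ κ Φ t p D g f hN hκ
  have hr' : 4 * (Neg.K κ : ℤ) * ((r : ℤ) + 2) ≤ (ML κ Φ t p D g : ℤ) := by exact_mod_cast hr
  have hK : (40 : ℤ) ≤ Neg.K κ := by exact_mod_cast (Neg.forty_le_K κ).1
  constructor
  · -- 160 K (r+2) ≤ 23 K (s₀+2)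
    have h : 160 * (Neg.K κ : ℤ) * ((r : ℤ) + 2) ≤ 23 * (Neg.K κ : ℤ) * ((((fcells κ Φ t p D g f).s 0 : ℕ) : ℤ) + 2) := by linarith
    have h' : 160 * ((r : ℤ) + 2) ≤ 23 * ((((fcells κ Φ t p D g f).s 0 : ℕ) : ℤ) + 2) := by
      by_contra hc; push Not at hc; nlinarith
    omega
  · have h : 160 * (Neg.K κ : ℤ) * ((r : ℤ) + 2) ≤ 11 * (Neg.K κ : ℤ) * ((((fcells κ Φ t p D g f).s 1 : ℕ) : ℤ) + 2) := by linarith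
    have h' : 160 * ((r : ℤ) + 2) ≤ 11 * ((((fcells κ Φ t p D g f).s 1 : ℕ) : ℤ) + 2) := by
      by_contra hc; push Not at hc; nlinarith
    omega

/-- **THE CELLS AT `g := gR`**: `6·RA' + 11 ≤ s₀` and `14·RA' + 27 ≤ s₁` (the apron `R′`; any width `f`). [folklore] -/
theorem cells_geR (κ : Consts) {V : Type} [DecidableEq V] [Countable V] {G : SimpleGraph V} [G.LocallyFinite] (Φ : PlanarSkeletonFrmFrom G) (t : V) (p : unitInterval) (D : Skelφ.StepI.DataNS V) (f : ℕ) (mk : ℕ) (gx : ℕ) (hN : EqNumL κ Φ t p D (gR mk gx κ Φ t p D) f) (hκ : (hL κ Φ t p D (gR mk gx κ Φ t p D) f).natAbs ≤ 10 * nL κ Φ t p D (gR mk gx κ Φ t p D) f) :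
    6 * (RA' κ Φ t p D mk : ℤ) + 11 ≤ (((fcells κ Φ t p D (gR mk gx κ Φ t p D) f).s 0 : ℕ) : ℤ) ∧
      14 * (RA' κ Φ t p D mk : ℤ) + 27 ≤ (((fcells κ Φ t p D (gR mk gx κ Φ t p D) f).s 1 : ℕ) : ℤ) :=
  s_ge_of_floor κ Φ t p D _ f hN hκ (ML_floorsR κ Φ t p D mk gx).1

/-- **The fine radii at `g := gR`**: `K·(6RA'+11) ≤ r₀`, `K·(14RA'+27) ≤ r₁`. [folklore] -/
theorem r_geR (κ : Consts) {V : Type} [DecidableEq V] [Countable V] {G : SimpleGraph V} [G.LocallyFinite] (Φ : PlanarSkeletonFrmFrom G) (t : V) (p : unitInterval) (D : Skelφ.StepI.DataNS V) (f : ℕ) (mk : ℕ) (gx : ℕ) (hN : EqNumL κ Φ t p D (gR mk gx κ Φ t p D) f) (hκ : (hL κ Φ t p D (gR mk gx κ Φ t p D) f).natAbs ≤ 10 * nL κ Φ t p D (gR mk gx κ Φ t p D) f) :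
    (Neg.K κ : ℤ) * (6 * (RA' κ Φ t p D mk : ℤ) + 11) ≤ ((fcells κ Φ t p D (gR mk gx κ Φ t p D) f).r 0 : ℤ) ∧
      (Neg.K κ : ℤ) * (14 * (RA' κ Φ t p D mk : ℤ) + 27) ≤ ((fcells κ Φ t p D (gR mk gx κ Φ t p D) f).r 1 : ℤ) := by
  obtain ⟨h0, h1⟩ := cells_geR κ Φ t p D f mk gx hN hκ
  have hr := (fcells_K κ Φ t p D (gR mk gx κ Φ t p D) f).2.2
  have hK : (0 : ℤ) ≤ Neg.K κ := by positivity
  rw [hr 0, hr 1]; push_cast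
  exact ⟨by nlinarith, by nlinarith⟩

end Cells

/-! ## §4 The pair slot value -/

/-- **THE PAIR LIST OF RECORD** (slot `mk`, residual pair slot `Px`): the bridge pair `(M_b, n_b)`, the kit pair `(M_kit, n_kit)`, and `Px`'s extras — each admissible. [this work] -/
def PR  (mk : ℕ) (Px : PSlot) : PSlot := fun κ _ _ _ _ _ Φ t p D =>
  ⟨{(MBR κ Φ t p D mk, nBR κ Φ t p D mk), (MK D mk, nKit D mk)} ∪ (Px κ Φ t p D).1, fun q hq => by
    rcases Finset.mem_union.1 hq with h | h
    · rcases Finset.mem_insert.1 h with rfl | h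
      · exact bridgeR_adm κ Φ t p D mk
      · rw [Finset.mem_singleton] at h; subst h; exact kit_adm D mk
    · exact (Px κ Φ t p D).2 q h⟩

section Pairs

/-- The bridge pair is listed. [folklore] -/
theorem bridge_mem_PR (κ : Consts) {V : Type} [DecidableEq V] [Countable V] {G : SimpleGraph V} [G.LocallyFinite] (Φ : PlanarSkeletonFrmFrom G) (t : V) (p : unitInterval) (D : Skelφ.StepI.DataNS V) (mk : ℕ) (Px : PSlot) : (MBR κ Φ t p D mk, nBR κ Φ t p D mk) ∈ (PR mk Px κ Φ t p D).1 :=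
  Finset.mem_union_left _ (Finset.mem_insert_self _ _)

/-- The kit pair is listed. [folklore] -/
theorem kit_mem_PR (κ : Consts) {V : Type} [DecidableEq V] [Countable V] {G : SimpleGraph V} [G.LocallyFinite] (Φ : PlanarSkeletonFrmFrom G) (t : V) (p : unitInterval) (D : Skelφ.StepI.DataNS V) (mk : ℕ) (Px : PSlot) : (MK D mk, nKit D mk) ∈ (PR mk Px κ Φ t p D).1 :=
  Finset.mem_union_left _ (Finset.mem_insert_of_mem (Finset.mem_singleton_self _))

/-- The extra pairs are listed. [folklore] -/
theorem extra_subset_PR (κ : Consts) {V : Type} [DecidableEq V] [Countable V] {G : SimpleGraph V} [G.LocallyFinite] (Φ : PlanarSkeletonFrmFrom G) (t : V) (p : unitInterval) (D : Skelφ.StepI.DataNS V) (mk : ℕ) (Px : PSlot) : (Px κ Φ t p D).1 ⊆ (PR mk Px κ Φ t p D).1 := Finset.subset_union_right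

end Pairs

section AtQ

end AtQ
end KS
end NegB
end PlanarSkeletonFrmFrom
end Summit.CriticalPhenomena.PercolationContinuityZ3.Theorems.Transplant
end
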